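import Mathlib
import Summits.ResolutionOfSingularities.ResolutionOfSingularities.Theorems.WildQuotientsWildQuotientResolutionLinearCyclicFourfoldAllP
import Summits.ResolutionOfSingularities.ResolutionOfSingularities.Theorems.WildQuotientsWildQuotientResolutionToricExitJordanThreeFinal
import Summits.ResolutionOfSingularities.ResolutionOfSingularities.Theorems.WildQuotientsWildQuotientResolutionToricExitJordanFourFinal

/-!
# The linear sector of `CyclicQuotientFourfolds` in every characteristic (unconditional)

(crux stmt-ResolutionOfSingularities-15640 `WildQuotients.WildQuotientResolution`, line `Sketch`,
sector `|G| = p`, LINEAR actions; `L/w45c/CHAIN.md` v7.9 §4 row stub-3 (3), registered stub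
`linearCyclicQuotientFourfold_hasResolution` BY NAME AND SIGNATURE.
[OURS · L1 W4.5c] — NOT a statement of any manuscript; replaces the role of no printed item.)

`LinearPowFour.linearCyclicQuotientFourfold_hasResolution`: for EVERY prime `p`, every field `k` of
characteristic `p` (not assumed perfect), every `n ≤ 4` and every LINEAR `k`-algebra automorphism
`σ` of `k[x₁,…,xₙ]` with `σ^p = 1` on the coordinates, the quotient `𝔸ⁿ_k/⟨σ⟩ = Spec k[x]^⟨σ⟩` has a
resolution of singularities. This is the all-characteristic skeleton
`linearCyclicQuotientFourfold_hasResolution_of_finals_all` (p516981: `p = 2` square-zero rung SQZ-4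
p478142; `p = 3` cube-zero normal form + the `J₃` final; `p ≥ 5` Jordan normal form
`linearCyclicQuotientFourfold_hasResolution_of_finals'` p490375) applied to the two landed finals:
RUNG V3U `ToricExit.jordanThree_hasResolution` (p517934, `J₃ ⊕ passengers`, every `p ≥ 3`) and
RUNG V4U `JordanFour.jordanFour_hasResolution` (p519868, `J₄ ⊕ passengers`, every `p ≥ 5`).
In particular every linear `ℤ/p`-quotient singularity of dimension `≤ 4` — including the unique
non-Cohen–Macaulay one `𝔸⁴/V₄` (`JordanBlockFourfold`, stmt-17942) — is resolved, in every
characteristic: the LINEAR sector of `CyclicQuotientFourfolds` (stmt-17941). Nothing is claimed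
about the non-linear sector (the open problem) nor about crepancy.
-/

set_option linter.dupNamespace false

noncomputable section

open MvPolynomial AlgebraicGeometry
open Literature.AlgebraicGeometry.Resolution

namespace Summit.ResolutionOfSingularities.ResolutionOfSingularities.Theorems.WildQuotientResolution.LinearPowFour

/-- **Every LINEAR `ℤ/p`-quotient of `𝔸ⁿ`, `n ≤ 4`, in every characteristic `p`, has a resolution of
singularities** (the linear sector of `CyclicQuotientFourfolds`, stmt-17941). [OURS · L1 W4.5c] -/
theorem linearCyclicQuotientFourfold_hasResolution (p : ℕ) (hp : p.Prime) (k : Type) [Field k]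
    [CharP k p] (n : ℕ) (hn : n ≤ 4) (σ : MvPolynomial (Fin n) k ≃ₐ[k] MvPolynomial (Fin n) k)
    (hlin : ∀ i, σ (X i) ∈ Submodule.span k (Set.range (X : Fin n → MvPolynomial (Fin n) k)))
    (hσp : ∀ i, (σ ^ p) (X i) = X i) :
    Scheme.HasResolution
      (Spec (.of (FixedPoints.subalgebra k (MvPolynomial (Fin n) k) (Subgroup.zpowers σ)))) :=
  linearCyclicQuotientFourfold_hasResolution_of_finals_all p hp k
    (fun hp3 n σ a b c hab hbc hac hb hc hσ =>
      ToricExit.jordanThree_hasResolution p hp hp3 k n σ a b c hab hbc hac hb hc hσ)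
    (fun hp5 n σ a b c d hab hac had hbc hbd hcd hb hc hd hσ =>
      JordanFour.jordanFour_hasResolution p hp hp5 k n σ a b c d hab hac had hbc hbd hcd hb hc hd hσ)
    n hn σ hlin hσp

end Summit.ResolutionOfSingularities.ResolutionOfSingularities.Theorems.WildQuotientResolution.LinearPowFour

end
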